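import Summits.RiemannHypothesis.RiemannHypothesis.Theorems.HandoffDodgerSlabFourProfile
import HarnessLib

/-!
# HANDOFF — FIFTH SLAB (2): the COUNTING profile-control constants at `y = 27`, `N₁ = 29`, `η` generic in a horizon floor `Tm` (rh-explicit, W-P(P2) crux 19185, seat dodger-p2 gen0; DODGER-STAGE2-PLAN §2 (c))

RH-FREE. HONEST FRAMING: nothing here bears on the truth of RH; part (2) of the discharge of the hypotheses of
`HandoffDodgerExplicitWindowCounting.dodger_witness_explicit_window_counting` (ATTEMPT-16 Lemma B3/D1 profile control) on the fifth
slab `1015 ≤ q < 7100` at the CONSTANT schedule `y = 27`, `N₁ = 29`. With `V = T₀²`, `AU = T₀/(25π) + s/2 + (T+¼)k/W` and the sizes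
of part (1) (`17100 ≤ T′`, `T₀ ≤ 1.01T′`, `T′² ≤ W`, `k′ ≤ 1.433T′`, `T′³/29.52 ≤ pL`, `s ≤ 11.27`): `x := 29V/pL ≤ 873.3/T′`,
`AU ≤ 0.01287T′ + 7.07`, hence **`η ≤ e^{u₀} − 1`** for any `u₀` with `(0.01287·Tm + 7.07)·762653 ≤ u₀·Tm·(Tm − 873.3)`, `Tm ≤ T′`
(per sub-slab floor `Tm = 16.89(A−1)` in the assembly); `λU = AU·V/pL ≤ 0.401`, `ρ₁ ≤ 0.811`, `3τ₁ + τ₂ ≤ 0.03`, `ρ₂U ≤ 1/4000 ≤ e^{−2}`,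
`τ₂U ≤ 10⁻⁴`, `N₁ + 1 ≤ pL/(2V)`; so `κ ≥ 2 − e^{u₀} − 0.03` (`profile_constants_slabFive`). No `sorry`, standard axioms, no definitions.

References: this track (ATTEMPT-16 §3 (B3), §5 (D1), ATTEMPT-19 §8, ATTEMPT-23 §7; HOME/rh-explicit-dodger-p2/DODGER-STAGE2-PLAN.md §2).
-/

set_option linter.dupNamespace false

noncomputable section

open Real

namespace Summit.RiemannHypothesis.RiemannHypothesis.Theorems.Handoff

/-- `30 ≤ pL/(2V)` on the fifth slab (`V = T₀² ≤ 1.0201T²`, `pL ≥ T³/29.52`, `T ≥ 17100`). [this track, DODGER-STAGE2-PLAN §2] -/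
theorem N_le_slabFive {T T₀ pL : ℝ} (hT : 17100 ≤ T) (hT₀0 : 0 < T₀) (hT₀T : T₀ ≤ 101 / 100 * T) (hpL : T ^ 3 / 29.52 ≤ pL) :
    (30 : ℝ) ≤ pL / (2 * T₀ ^ 2) := by
  have hT0 : 0 < T := by linarith
  rw [le_div_iff₀ (by positivity)]
  have h4 : T ^ 3 ≤ 29.52 * pL := by rw [div_le_iff₀ (by norm_num)] at hpL; linarith only [hpL]
  have hV : T₀ ^ 2 ≤ (101 / 100 * T) ^ 2 := pow_le_pow_left₀ hT₀0.le hT₀T 2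
  nlinarith only [h4, hV, hT, hT0]

/-- `x = 29V/pL ≤ 873.3/T` on the fifth slab. [this track, DODGER-STAGE2-PLAN §2] -/
theorem x_le_slabFive {T T₀ pL : ℝ} (hT : 17100 ≤ T) (hT₀0 : 0 < T₀) (hT₀T : T₀ ≤ 101 / 100 * T) (hpL : T ^ 3 / 29.52 ≤ pL) :
    T₀ ^ 2 * (29 : ℝ) / pL ≤ 873.3 / T := by
  have hT0 : 0 < T := by linarith
  have hpL0 : 0 < pL := lt_of_lt_of_le (by positivity) hpL
  rw [div_le_div_iff₀ hpL0 hT0]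
  have h4 : T ^ 3 ≤ 29.52 * pL := by rw [div_le_iff₀ (by norm_num)] at hpL; linarith only [hpL]
  have hV : T₀ ^ 2 ≤ (101 / 100 * T) ^ 2 := pow_le_pow_left₀ hT₀0.le hT₀T 2
  nlinarith only [h4, hV, hT0, hpL0]

/-- `AU = T₀/(25π) + s/2 + (T+¼)k/W ≤ 0.01287T + 7.07` on the fifth slab. [this track, DODGER-STAGE2-PLAN §2] -/
theorem AU_le_slabFive {T T₀ s k W AU : ℝ} (hT : 17100 ≤ T) (hT₀T : T₀ ≤ 101 / 100 * T) (hs : s ≤ 11.27)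
    (hk : k ≤ 1.433 * T) (hW1 : T ^ 2 ≤ W)
    (hAU : AU = T₀ / (25 * π) + s / 2 + (T + 1 / 4) * k / W) : AU ≤ 0.01287 * T + 7.07 := by
  have hT0 : 0 < T := by linarith
  have hW0 : 0 < W := lt_of_lt_of_le (by positivity) hW1
  have hπ : 3.1415 < π := Real.pi_gt_d4
  rw [hAU]
  have h1 : T₀ / (25 * π) ≤ 0.012861 * T := by
    rw [div_le_iff₀ (by positivity)]; nlinarith only [hT₀T, hπ, hT0]
  have h3 : (T + 1 / 4) * k / W ≤ 1.434 := by
    rw [div_le_iff₀ hW0]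
    have : (T + 1 / 4) * k ≤ (T + 1 / 4) * (1.433 * T) := mul_le_mul_of_nonneg_left hk (by linarith)
    nlinarith only [this, hW1, hT, hT0]
  linarith only [h1, h3, hs, hT0]

/-- **`η ≤ e^{u₀} − 1`** on the fifth slab, GENERIC in a horizon floor `Tm ≤ T`: `AU·x²/(1−x) ≤ u₀` whenever
`(0.01287·Tm + 7.07)·762653 ≤ u₀·Tm·(Tm − 873.3)` (`x ≤ 873.3/T`, `873.3² ≤ 762653`). [this track, DODGER-STAGE2-PLAN §2] -/
theorem eta_le_slabFive {T Tm AU x ηU u₀ : ℝ} (hT : 17100 ≤ T) (hTm : 17100 ≤ Tm) (hTmT : Tm ≤ T)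
    (hAUle : AU ≤ 0.01287 * T + 7.07) (hx0 : 0 ≤ x) (hxle : x ≤ 873.3 / T)
    (hηU : ηU = Real.exp (AU * x ^ 2 / (1 - x)) - 1)
    (hu₀ : (0.01287 * Tm + 7.07) * 762653 ≤ u₀ * (Tm * (Tm - 873.3))) : ηU ≤ Real.exp u₀ - 1 := by
  have hT0 : 0 < T := by linarith
  have hTm0 : 0 < Tm := by linarith
  have hxm : 873.3 / T ≤ 873.3 / Tm := div_le_div_of_nonneg_left (by norm_num) hTm0 hTmT
  have hxm1 : 873.3 / Tm ≤ 0.052 := by rw [div_le_iff₀ hTm0]; linarith only [hTm]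
  have hx1 : x < 1 := by linarith only [hxle, hxm, hxm1]
  rw [hηU]
  have hg : AU * x ^ 2 / (1 - x) ≤ u₀ := by
    -- numerator: `AU·x² ≤ (0.01287T + 7.07)(873.3/T)² ≤ (0.01287Tm + 7.07)·762653/Tm²`
    have hn1 : AU * x ^ 2 ≤ (0.01287 * T + 7.07) * (873.3 / T) ^ 2 :=
      mul_le_mul hAUle (pow_le_pow_left₀ hx0 hxle 2) (sq_nonneg x) (by positivity)
    have hn2 : (0.01287 * T + 7.07) * (873.3 / T) ^ 2 ≤ (0.01287 * Tm + 7.07) * 762653 / Tm ^ 2 := by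
      rw [div_pow, ← mul_div_assoc, div_le_div_iff₀ (by positivity) (by positivity)]
      have h1 : (873.3 : ℝ) ^ 2 ≤ 762653 := by norm_num
      -- `(aT + c)·Tm² ≤ (aTm + c)·T²` for `Tm ≤ T`
      have h2 : (0.01287 * T + 7.07) * Tm ^ 2 ≤ (0.01287 * Tm + 7.07) * T ^ 2 := by
        have hd : 0 ≤ T - Tm := by linarith only [hTmT]
        nlinarith only [hd, hTm0, hT0, mul_nonneg (mul_nonneg hd hTm0.le) hT0.le]
      calc (0.01287 * T + 7.07) * 873.3 ^ 2 * Tm ^ 2 = ((0.01287 * T + 7.07) * Tm ^ 2) * 873.3 ^ 2 := by ring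
        _ ≤ ((0.01287 * Tm + 7.07) * T ^ 2) * 762653 := mul_le_mul h2 h1 (by positivity) (by positivity)
        _ = (0.01287 * Tm + 7.07) * 762653 * T ^ 2 := by ring
    have hden : 1 - 873.3 / Tm ≤ 1 - x := by linarith only [hxle, hxm]
    have hden0 : 0 < 1 - 873.3 / Tm := by linarith only [hxm1]
    calc AU * x ^ 2 / (1 - x) ≤ ((0.01287 * Tm + 7.07) * 762653 / Tm ^ 2) / (1 - x) :=
          div_le_div_of_nonneg_right (hn1.trans hn2) (by linarith only [hx1])
      _ ≤ ((0.01287 * Tm + 7.07) * 762653 / Tm ^ 2) / (1 - 873.3 / Tm) :=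
          div_le_div_of_nonneg_left (by positivity) hden0 hden
      _ = (0.01287 * Tm + 7.07) * 762653 / (Tm * (Tm - 873.3)) := by
          field_simp
      _ ≤ u₀ := by
          have h873 : 0 < Tm - 873.3 := by linarith only [hTm]
          rw [div_le_iff₀ (mul_pos hTm0 h873)]
          exact hu₀
  linarith only [Real.exp_le_exp.2 hg]

/-- `λU = AU·V/pL ≤ 0.401` on the fifth slab. [this track, DODGER-STAGE2-PLAN §2] -/
theorem lam_le_slabFive {T T₀ pL AU lamU : ℝ} (hT : 17100 ≤ T) (hT₀0 : 0 < T₀) (hT₀T : T₀ ≤ 101 / 100 * T)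
    (hpL : T ^ 3 / 29.52 ≤ pL) (hAUle : AU ≤ 0.01287 * T + 7.07) (hlamU : lamU = AU * T₀ ^ 2 / pL) :
    lamU ≤ 0.401 := by
  have hT0 : 0 < T := by linarith
  have hpL0 : 0 < pL := lt_of_lt_of_le (by positivity) hpL
  rw [hlamU, div_le_iff₀ hpL0]
  have h4 : T ^ 3 ≤ 29.52 * pL := by rw [div_le_iff₀ (by norm_num)] at hpL; linarith only [hpL]
  have hV : T₀ ^ 2 ≤ (101 / 100 * T) ^ 2 := pow_le_pow_left₀ hT₀0.le hT₀T 2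
  have h1 : AU * T₀ ^ 2 ≤ (0.01287 * T + 7.07) * (101 / 100 * T) ^ 2 := mul_le_mul hAUle hV (by positivity) (by positivity)
  nlinarith only [h1, h4, hT, hT0]

/-- `ρ₁ ≤ 0.811` at `y = 27`, `N₁ = 29`, `λU ≤ 0.401`. [this track, DODGER-STAGE2-PLAN §2] -/
theorem rho1_le_slabFive {lamU ρ1 y : ℝ} {N₁ : ℕ} (hlam : lamU ≤ 0.401) (hy : y = 27) (hN₁ : N₁ = 29)
    (hρ1 : ρ1 = Real.exp (3 + lamU) * (4 * y ^ 2) / (4 * ((N₁ : ℝ) + 1) ^ 3)) : ρ1 ≤ 0.811 := by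
  have hexp : Real.exp (3 + lamU) ≤ 29.998 := by
    rw [Real.exp_add]
    have h3 : Real.exp 3 ≤ 20.0856 := by
      have e : Real.exp 1 ^ 3 = Real.exp 3 := by exact_mod_cast Real.exp_one_pow 3
      rw [← e]
      have := Real.exp_one_lt_d9
      have h := pow_le_pow_left₀ (Real.exp_pos 1).le this.le 3
      exact h.trans (by norm_num)
    have h4 : Real.exp lamU ≤ 1.4935 := by
      refine (Real.exp_le_exp.2 hlam).trans ?_
      have := Real.exp_bound' (x := (0.401 : ℝ)) (by norm_num) (by norm_num) (n := 4) (by norm_num)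
      simp only [Finset.sum_range_succ, Finset.sum_range_zero, Nat.factorial] at this
      norm_num at this
      linarith
    calc Real.exp 3 * Real.exp lamU ≤ 20.0856 * 1.4935 := mul_le_mul h3 h4 (Real.exp_pos _).le (by norm_num)
      _ ≤ 29.998 := by norm_num
  rw [hρ1, hy, hN₁, div_le_iff₀ (by positivity)]
  push_cast
  nlinarith only [hexp]

/-- `τ₁ ≤ 0.0099` from `ρ₁ ≤ 0.811` and `N₁ = 29`. [this track, DODGER-STAGE2-PLAN §2] -/
theorem tau1_le_slabFive {ρ1 τ1 : ℝ} {N₁ : ℕ} (hρ1ge : 0 ≤ ρ1) (hρ1le : ρ1 ≤ 0.811) (hN₁ : N₁ = 29)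
    (hτ1 : τ1 = ρ1 ^ (N₁ + 1) / (1 - ρ1)) : τ1 ≤ 99 / 10000 := by
  rw [hτ1, hN₁, div_le_iff₀ (by linarith only [hρ1le])]
  have h2 : ρ1 ^ (29 + 1) ≤ (0.811 : ℝ) ^ (29 + 1) := pow_le_pow_left₀ hρ1ge hρ1le _
  have h3 : (0.811 : ℝ) ^ (29 + 1) ≤ 187 / 100000 := by norm_num
  nlinarith only [h2, h3, hρ1le]

/-- `ρ₂U = 8e²V³y²/pL³ ≤ 1/4000` at `y = 27` on the fifth slab. [this track, DODGER-STAGE2-PLAN §2] -/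
theorem rho2_le_slabFive {T T₀ pL ρ2U y : ℝ} (hT : 17100 ≤ T) (hT₀0 : 0 < T₀) (hT₀T : T₀ ≤ 101 / 100 * T)
    (hpL : T ^ 3 / 29.52 ≤ pL) (hy : y = 27) (hρ2U : ρ2U = 8 * Real.exp 2 * (T₀ ^ 2) ^ 3 * y ^ 2 / pL ^ 3) :
    ρ2U ≤ 1 / 4000 := by
  have hT0 : 0 < T := by linarith
  have hpL0 : 0 < pL := lt_of_lt_of_le (by positivity) hpL
  rw [hρ2U, hy, div_le_iff₀ (by positivity)]
  have hV : T₀ ^ 2 ≤ 1.0201 * T ^ 2 := by nlinarith only [pow_le_pow_left₀ hT₀0.le hT₀T 2]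
  have hW3' : (T₀ ^ 2) ^ 3 ≤ (1.0201 * T ^ 2) ^ 3 := pow_le_pow_left₀ (by positivity) hV 3
  have hp3 : (T ^ 3 / 29.52) ^ 3 ≤ pL ^ 3 := pow_le_pow_left₀ (by positivity) hpL 3
  have e2 := exp_numerics.1
  have h1 : 8 * Real.exp 2 * (T₀ ^ 2) ^ 3 * (27 : ℝ) ^ 2 ≤ 8 * 7.39 * (1.0201 * T ^ 2) ^ 3 * 27 ^ 2 := by
    have := mul_le_mul e2.le hW3' (by positivity) (by norm_num)
    nlinarith only [this]
  have h2 : 8 * 7.39 * (1.0201 * T ^ 2) ^ 3 * (27 : ℝ) ^ 2 ≤ 1 / 4000 * (T ^ 3 / 29.52) ^ 3 := by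
    have e1 : (T ^ 3 / 29.52) ^ 3 = T ^ 6 * T ^ 3 / 29.52 ^ 3 := by ring
    have e3 : 8 * 7.39 * (1.0201 * T ^ 2) ^ 3 * (27 : ℝ) ^ 2 = 8 * 7.39 * 1.0201 ^ 3 * 27 ^ 2 * T ^ 6 := by ring
    rw [e1, e3]
    have hT3 : (17100 : ℝ) ^ 3 ≤ T ^ 3 := pow_le_pow_left₀ (by norm_num) hT 3
    have hT6 : (0 : ℝ) ≤ T ^ 6 := by positivity
    have key : 8 * 7.39 * 1.0201 ^ 3 * 27 ^ 2 * ((29.52 : ℝ) ^ 3 * 4000) ≤ T ^ 3 := le_trans (by norm_num) hT3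
    have hk := mul_le_mul_of_nonneg_left key hT6
    rw [show 1 / 4000 * (T ^ 6 * T ^ 3 / 29.52 ^ 3) = T ^ 6 * T ^ 3 / ((29.52 : ℝ) ^ 3 * 4000) by ring]
    rw [le_div_iff₀ (by norm_num)]
    nlinarith only [hk]
  nlinarith only [h1, h2, hp3]

/-- `τ₂U ≤ 10⁻⁴` on the fifth slab (`τ₂U = exp(pL/(2V)(1 + log ρ₂U) + AU/2)/(1 − ρ₂U)`, `ρ₂U ≤ 1/4000`, `pL/(2V) ≥ T/60.3`,
`AU ≤ 0.01287T + 7.07`). [this track, DODGER-STAGE2-PLAN §2] -/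
theorem tau2_le_slabFive {T T₀ pL AU ρ2U τ2U : ℝ} (hT : 17100 ≤ T) (hT₀0 : 0 < T₀) (hT₀T : T₀ ≤ 101 / 100 * T)
    (hpL : T ^ 3 / 29.52 ≤ pL) (hAUle : AU ≤ 0.01287 * T + 7.07)
    (hρ2ge : 0 < ρ2U) (hρ2le : ρ2U ≤ 1 / 4000)
    (hτ2U : τ2U = Real.exp (pL / (2 * T₀ ^ 2) * (1 + Real.log ρ2U) + AU / 2) / (1 - ρ2U)) :
    τ2U ≤ 1 / 10000 := by
  have hT0 : 0 < T := by linarith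
  have hpL0 : 0 < pL := lt_of_lt_of_le (by positivity) hpL
  rw [hτ2U, div_le_iff₀ (by linarith only [hρ2le])]
  have hlog : Real.log ρ2U ≤ -8 := by
    rw [Real.log_le_iff_le_exp hρ2ge]
    refine hρ2le.trans ?_
    rw [Real.exp_neg, le_inv_comm₀ (by norm_num) (Real.exp_pos _)]
    have h8 : Real.exp 8 = Real.exp 4 * Real.exp 4 := by rw [← Real.exp_add]; norm_num
    rw [h8]; nlinarith only [exp_numerics.2.2.1, Real.exp_pos 4]
  have hpW : 30 ≤ pL / (2 * T₀ ^ 2) := N_le_slabFive hT hT₀0 hT₀T hpL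
  have hpV : T / 60.3 ≤ pL / (2 * T₀ ^ 2) := by
    rw [div_le_div_iff₀ (by norm_num) (by positivity)]
    have h4 : T ^ 3 ≤ 29.52 * pL := by rw [div_le_iff₀ (by norm_num)] at hpL; linarith only [hpL]
    have hV : T₀ ^ 2 ≤ (101 / 100 * T) ^ 2 := pow_le_pow_left₀ hT₀0.le hT₀T 2
    nlinarith only [h4, hV, hT0, hpL0]
  have hX : pL / (2 * T₀ ^ 2) * (1 + Real.log ρ2U) + AU / 2 ≤ -10 := by
    have h1 : 1 + Real.log ρ2U ≤ -7 := by linarith only [hlog]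
    have h2 : pL / (2 * T₀ ^ 2) * (1 + Real.log ρ2U) ≤ -(T / 9) := by
      have hP0 : 0 ≤ pL / (2 * T₀ ^ 2) := by positivity
      have h3 : pL / (2 * T₀ ^ 2) * (1 + Real.log ρ2U) ≤ pL / (2 * T₀ ^ 2) * (-7) :=
        mul_le_mul_of_nonneg_left h1 hP0
      have hpV' : T ≤ pL / (2 * T₀ ^ 2) * 60.3 := (div_le_iff₀ (by norm_num : (0:ℝ) < 60.3)).1 hpV
      linarith only [h3, hpV', hT]
    linarith only [h2, hAUle, hT]
  have hE : Real.exp (pL / (2 * T₀ ^ 2) * (1 + Real.log ρ2U) + AU / 2) ≤ 1 / 20000 := by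
    refine (Real.exp_le_exp.2 hX).trans ?_
    rw [Real.exp_neg, inv_le_comm₀ (Real.exp_pos _) (by norm_num)]
    have h10 : Real.exp 10 = Real.exp 4 * Real.exp 4 * Real.exp 2 := by rw [← Real.exp_add, ← Real.exp_add]; norm_num
    rw [h10]; norm_num; nlinarith only [exp_numerics.2.2.2, exp_numerics.2.1, Real.exp_pos 2, Real.exp_pos 4]
  nlinarith only [hE, hρ2le, Real.exp_pos (pL / (2 * T₀ ^ 2) * (1 + Real.log ρ2U) + AU / 2)]

/-- **Part (2) of the fifth-slab discharge: the COUNTING profile-control constants at `y = 27`, `N₁ = 29`, `η` generic.**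
`N₁+1 ≤ pL/(2V)`, `ρ₁ < 1`, `ρ₂U ≤ e^{−2}`, and `2 − e^{u₀} − 0.03 ≤ κ` for any `u₀` with `(0.01287·Tm + 7.07)·762653 ≤ u₀·Tm·(Tm − 873.3)`,
`17100 ≤ Tm ≤ T`. [this track, DODGER-STAGE2-PLAN §2] -/
theorem profile_constants_slabFive {b T T₀ k pL W s y V AU lamU ρ1 ρ2U ηU τ1 τ2U κ Tm u₀ : ℝ} {N₁ : ℕ}
    (hb1 : b ≤ 9 / 2) (hT : 17100 ≤ T) (hT₀0 : 0 < T₀) (hT₀T : T₀ ≤ 101 / 100 * T) (hTm : 17100 ≤ Tm) (hTmT : Tm ≤ T)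
    (hW1 : T ^ 2 ≤ W) (hk0 : 2 ≤ k) (hk : k ≤ 0.3184 * b * T) (hpL : T ^ 3 / 29.52 ≤ pL) (hs0 : 0 ≤ s) (hs : s ≤ 11.27)
    (hy : y = 27) (hN₁ : N₁ = 29) (hV : V = T₀ ^ 2)
    (hAU : AU = T₀ / (25 * π) + s / 2 + (T + 1 / 4) * k / W)
    (hηU : ηU = Real.exp (AU * (V * (N₁ : ℝ) / pL) ^ 2 / (1 - V * (N₁ : ℝ) / pL)) - 1)
    (hlamU : lamU = AU * V / pL)
    (hρ1 : ρ1 = Real.exp (3 + lamU) * (4 * y ^ 2) / (4 * ((N₁ : ℝ) + 1) ^ 3))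
    (hρ2U : ρ2U = 8 * Real.exp 2 * V ^ 3 * y ^ 2 / pL ^ 3)
    (hτ1 : τ1 = ρ1 ^ (N₁ + 1) / (1 - ρ1))
    (hτ2U : τ2U = Real.exp (pL / (2 * V) * (1 + Real.log ρ2U) + AU / 2) / (1 - ρ2U))
    (hκ : κ = 1 - ηU - 3 * τ1 - τ2U)
    (hu₀ : (0.01287 * Tm + 7.07) * 762653 ≤ u₀ * (Tm * (Tm - 873.3))) :
    (N₁ : ℝ) + 1 ≤ pL / (2 * V) ∧ ρ1 < 1 ∧ ρ2U ≤ Real.exp (-2) ∧ 2 - Real.exp u₀ - 3 / 100 ≤ κ := by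
  have hT0 : 0 < T := by linarith
  have hW0 : 0 < W := lt_of_lt_of_le (by positivity) hW1
  have hk00 : 0 ≤ k := by linarith only [hk0]
  have hk' : k ≤ 1.433 * T := by nlinarith only [hk, hb1, hT0]
  have hpL0 : 0 < pL := lt_of_lt_of_le (by positivity) hpL
  have hAU0 : 0 ≤ AU := by rw [hAU]; positivity
  have hAUle := AU_le_slabFive hT hT₀T hs hk' hW1 hAU
  subst hV
  have hN : (N₁ : ℝ) + 1 ≤ pL / (2 * T₀ ^ 2) := by
    rw [hN₁]; push_cast
    have := N_le_slabFive hT hT₀0 hT₀T hpL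
    linarith only [this]
  have hlam0 : 0 ≤ lamU := by rw [hlamU]; positivity
  have hlamle := lam_le_slabFive hT hT₀0 hT₀T hpL hAUle hlamU
  have hρ1le := rho1_le_slabFive hlamle hy hN₁ hρ1
  have hρ1ge : 0 ≤ ρ1 := by rw [hρ1]; positivity
  have hτ1le := tau1_le_slabFive hρ1ge hρ1le hN₁ hτ1
  have hρ2le := rho2_le_slabFive hT hT₀0 hT₀T hpL hy hρ2U
  have hρ2ge : 0 < ρ2U := by rw [hρ2U, hy]; positivity
  have hρ2e : ρ2U ≤ Real.exp (-2) := by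
    refine hρ2le.trans ?_
    rw [Real.exp_neg, le_inv_comm₀ (by norm_num) (Real.exp_pos _)]
    have := exp_numerics.1; norm_num; linarith only [this]
  have hτ2le := tau2_le_slabFive hT hT₀0 hT₀T hpL hAUle hρ2ge hρ2le hτ2U
  -- `η ≤ e^{u₀} − 1` with `x = 29V/pL`
  have hx0 : 0 ≤ T₀ ^ 2 * (N₁ : ℝ) / pL := by positivity
  have hxle : T₀ ^ 2 * (N₁ : ℝ) / pL ≤ 873.3 / T := by
    rw [hN₁]; push_cast; exact x_le_slabFive hT hT₀0 hT₀T hpL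
  have hηle := eta_le_slabFive hT hTm hTmT hAUle hx0 hxle hηU hu₀
  refine ⟨hN, by linarith only [hρ1le], hρ2e, ?_⟩
  rw [hκ]; linarith only [hηle, hτ1le, hτ2le]

end Summit.RiemannHypothesis.RiemannHypothesis.Theorems.Handoff

end
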